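import Literature.Probability.Process.StableLikeJumpChainKernel
import Literature.Probability.Process.StableLikeJumpChainLattice
import HarnessLib

/-!
# Moments and kernel geometry for stable-like chains on `ℤ^d`

Support file for the proof of Bass–Levin 2002, Theorem 1.1
(`Literature.Probability.Process.bassLevin_thm_1_1`): geometric estimates feeding the
entropy–moment (Nash 1958) tightness argument that replaces Bass–Levin Thm 2.8 in our route.
For a Markov kernel `P` on `ℤ^d` with `P x y ≤ c₂ ‖x−y‖^{-(d+α)}` (and its powers `Q`):

* `one_step_moment` : `∑_u P w u (1+‖u−x‖)^β ≤ (1+‖w−x‖)^β + C₁` for `0 < β < α`, `β ≤ 1`;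
* `kpow_moment_summable` : the moments `M(k) = ∑_z Q k x z (1+‖z−x‖)^β` are finite and
  `M(k+1) ≤ M(k) + C₁`;
* `kpow_two_upper` : `Q 2 y z ≤ C ‖y−z‖^{-(d+α)}` for `y ≠ z` (reversible kernel);
* `gamma_bound` : the "carré du champ" of `z ↦ (1+‖z−x‖)^β` under the two-step kernel,
  `∑_z Q 2 y z ((1+‖y−x‖)^β − (1+‖z−x‖)^β)² ≤ C (1+‖y−x‖)^{2β−α}` for `2β < α`;
* `inverse_moment_bound` : anti-concentration from an on-diagonal bound,
  `∑_z Q n x z (1+‖z−x‖)^{-γ} ≤ C n^{-γ/α}` (`0 < γ < d`... here `γ ≤ 1 ≤ d`).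

All constants are explicit but only their positivity/finiteness matters. [folklore]

## References
* R. F. Bass, D. A. Levin, *Transition probabilities for symmetric jump processes*,
  Trans. Amer. Math. Soc. 354 (2002) 2933–2953, §2 (Thm 2.8) — the statement these estimates
  serve to replace.
* J. Nash, *Continuity of solutions of parabolic and elliptic equations*, Amer. J. Math. 80
  (1958) 931–954 (moment bound).
-/

noncomputable section

namespace Literature.Probability.Process

open scoped BigOperators

variable {d : ℕ} {P : (Fin d → ℤ) → (Fin d → ℤ) → ℝ} {Q : ℕ → (Fin d → ℤ) → (Fin d → ℤ) → ℝ}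
  {μ : (Fin d → ℤ) → ℝ} {m M c₁ c₂ α : ℝ}

/-! ### One-step moments -/

/-- Kernel bound times a power of the distance: `P w u ‖u−w‖^β ≤ c₂ ‖u−w‖^{β−(d+α)}` for
`u ≠ w`, and the family `u ↦ P w u ‖u−w‖^β` is summable with sum `≤ c₂ Z_{d+α−β}` for
`β < α`. [folklore] -/
theorem tsum_kernel_mul_norm_rpow_le (hd : 1 ≤ d) (hP0 : ∀ x y, 0 ≤ P x y)
    (hub : ∀ x y, P x y ≤ c₂ * ‖x - y‖ ^ (-((d : ℝ) + α))) (hc₂ : 0 ≤ c₂)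
    {β : ℝ} (hβ : 0 < β) (hβα : β < α) (w : Fin d → ℤ) :
    (Summable fun u => P w u * ‖u - w‖ ^ β) ∧
      ∑' u, P w u * ‖u - w‖ ^ β ≤ c₂ * (3 ^ d + 2 * d * 3 ^ (d - 1) / (α - β)) := by
  set t : ℝ := (d : ℝ) + α - β with ht
  have hdt : (d : ℝ) < t := by rw [ht]; linarith
  obtain ⟨hZs, hZle⟩ := summable_norm_rpow_neg hd hdt
  have htd : t - d = α - β := by rw [ht]; ring
  rw [htd] at hZle
  -- pointwise bound by the translated lattice family
  have hpt : ∀ u, P w u * ‖u - w‖ ^ β ≤ c₂ * (if u - w = 0 then (0 : ℝ) else ‖u - w‖ ^ (-t)) := by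
    intro u
    by_cases hu : u - w = 0
    · rw [if_pos hu, hu, norm_zero, Real.zero_rpow hβ.ne', mul_zero, mul_zero]
    · rw [if_neg hu]
      have hpos : 0 < ‖u - w‖ := norm_pos_iff.mpr hu
      calc P w u * ‖u - w‖ ^ β ≤ c₂ * ‖w - u‖ ^ (-((d : ℝ) + α)) * ‖u - w‖ ^ β :=
            mul_le_mul_of_nonneg_right (hub w u) (Real.rpow_nonneg (norm_nonneg _) _)
        _ = c₂ * ‖u - w‖ ^ (-t) := by
            rw [norm_sub_rev, mul_assoc, ← Real.rpow_add hpos]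
            congr 2; rw [ht]; ring
  have hmaj : Summable fun u => c₂ * (if u - w = 0 then (0 : ℝ) else ‖u - w‖ ^ (-t)) :=
    ((Equiv.subRight w).summable_iff.mpr hZs).mul_left c₂
  have hnn : ∀ u, 0 ≤ P w u * ‖u - w‖ ^ β := fun u =>
    mul_nonneg (hP0 w u) (Real.rpow_nonneg (norm_nonneg _) _)
  refine ⟨hmaj.of_nonneg_of_le hnn hpt, ?_⟩
  calc ∑' u, P w u * ‖u - w‖ ^ β ≤ ∑' u, c₂ * (if u - w = 0 then (0 : ℝ) else ‖u - w‖ ^ (-t)) :=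
        Summable.tsum_le_tsum hpt (hmaj.of_nonneg_of_le hnn hpt) hmaj
    _ = c₂ * ∑' u, (if u - w = 0 then (0 : ℝ) else ‖u - w‖ ^ (-t)) := tsum_mul_left
    _ = c₂ * ∑' h : Fin d → ℤ, (if h = 0 then (0 : ℝ) else ‖h‖ ^ (-t)) := by
        congr 1
        exact (Equiv.subRight w).tsum_eq (fun h => if h = 0 then (0 : ℝ) else ‖h‖ ^ (-t))
    _ ≤ c₂ * (3 ^ d + 2 * d * 3 ^ (d - 1) / (α - β)) := mul_le_mul_of_nonneg_left hZle hc₂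

/-- **One-step moment bound**: `∑_u P w u (1+‖u−x‖)^β ≤ (1+‖w−x‖)^β + C₁` with
`C₁ = c₂ (3^d + 2d3^{d-1}/(α-β))`, for `0 < β ≤ 1`, `β < α`; and the family is summable.
[folklore] -/
theorem one_step_moment (hd : 1 ≤ d) (hP0 : ∀ x y, 0 ≤ P x y) (hP1 : ∀ x, HasSum (P x) 1)
    (hub : ∀ x y, P x y ≤ c₂ * ‖x - y‖ ^ (-((d : ℝ) + α))) (hc₂ : 0 ≤ c₂)
    {β : ℝ} (hβ : 0 < β) (hβ1 : β ≤ 1) (hβα : β < α) (x w : Fin d → ℤ) :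
    (Summable fun u => P w u * (1 + ‖u - x‖) ^ β) ∧
      ∑' u, P w u * (1 + ‖u - x‖) ^ β ≤
        (1 + ‖w - x‖) ^ β + c₂ * (3 ^ d + 2 * d * 3 ^ (d - 1) / (α - β)) := by
  obtain ⟨hs, hle⟩ := tsum_kernel_mul_norm_rpow_le hd hP0 hub hc₂ hβ hβα w
  have hPs : Summable (P w) := (hP1 w).summable
  -- subadditivity: (1 + ‖u - x‖)^β ≤ (1 + ‖w - x‖)^β + ‖u - w‖^β
  have hsub : ∀ u, (1 + ‖u - x‖) ^ β ≤ (1 + ‖w - x‖) ^ β + ‖u - w‖ ^ β := by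
    intro u
    have htri : 1 + ‖u - x‖ ≤ (1 + ‖w - x‖) + ‖u - w‖ := by
      have : ‖u - x‖ ≤ ‖u - w‖ + ‖w - x‖ := by
        calc ‖u - x‖ = ‖(u - w) + (w - x)‖ := by congr 1; abel
          _ ≤ ‖u - w‖ + ‖w - x‖ := norm_add_le _ _
      linarith
    calc (1 + ‖u - x‖) ^ β ≤ ((1 + ‖w - x‖) + ‖u - w‖) ^ β :=
          Real.rpow_le_rpow (by positivity) htri hβ.le
      _ ≤ (1 + ‖w - x‖) ^ β + ‖u - w‖ ^ β :=
          Real.rpow_add_le_add_rpow (by positivity) (norm_nonneg _) hβ.le hβ1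
  have hpt : ∀ u, P w u * (1 + ‖u - x‖) ^ β ≤ (1 + ‖w - x‖) ^ β * P w u + P w u * ‖u - w‖ ^ β := by
    intro u
    calc P w u * (1 + ‖u - x‖) ^ β ≤ P w u * ((1 + ‖w - x‖) ^ β + ‖u - w‖ ^ β) :=
          mul_le_mul_of_nonneg_left (hsub u) (hP0 w u)
      _ = (1 + ‖w - x‖) ^ β * P w u + P w u * ‖u - w‖ ^ β := by ring
  have hmaj : Summable fun u => (1 + ‖w - x‖) ^ β * P w u + P w u * ‖u - w‖ ^ β :=
    (hPs.mul_left _).add hs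
  have hnn : ∀ u, 0 ≤ P w u * (1 + ‖u - x‖) ^ β := fun u =>
    mul_nonneg (hP0 w u) (Real.rpow_nonneg (by positivity) _)
  refine ⟨hmaj.of_nonneg_of_le hnn hpt, ?_⟩
  calc ∑' u, P w u * (1 + ‖u - x‖) ^ β ≤ ∑' u, ((1 + ‖w - x‖) ^ β * P w u + P w u * ‖u - w‖ ^ β) :=
        Summable.tsum_le_tsum hpt (hmaj.of_nonneg_of_le hnn hpt) hmaj
    _ = (1 + ‖w - x‖) ^ β * ∑' u, P w u + ∑' u, P w u * ‖u - w‖ ^ β := by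
        rw [Summable.tsum_add (hPs.mul_left _) hs, tsum_mul_left]
    _ ≤ (1 + ‖w - x‖) ^ β + c₂ * (3 ^ d + 2 * d * 3 ^ (d - 1) / (α - β)) := by
        rw [(hP1 w).tsum_eq, mul_one]; exact add_le_add le_rfl hle

/-- **A priori moments**: the `β`-moments `M(k) = ∑_z Q k x z (1+‖z−x‖)^β` are finite for every
`k` and grow at most linearly, `M(k+1) ≤ M(k) + C₁`. [folklore] -/
theorem kpow_moment_summable (hd : 1 ≤ d) (hP0 : ∀ x y, 0 ≤ P x y) (hP1 : ∀ x, HasSum (P x) 1)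
    (hub : ∀ x y, P x y ≤ c₂ * ‖x - y‖ ^ (-((d : ℝ) + α))) (hc₂ : 0 ≤ c₂)
    (hQ0 : ∀ x y, Q 0 x y = if x = y then 1 else 0)
    (hQ : ∀ n x y, Q (n + 1) x y = ∑' z, Q n x z * P z y)
    {β : ℝ} (hβ : 0 < β) (hβ1 : β ≤ 1) (hβα : β < α) (x : Fin d → ℤ) (k : ℕ) :
    (Summable fun z => Q k x z * (1 + ‖z - x‖) ^ β) ∧
      ∑' z, Q (k + 1) x z * (1 + ‖z - x‖) ^ β ≤
        ∑' z, Q k x z * (1 + ‖z - x‖) ^ β + c₂ * (3 ^ d + 2 * d * 3 ^ (d - 1) / (α - β)) := by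
  have hPs : ∀ x, Summable (P x) := fun x => (hP1 x).summable
  have hP1' : ∀ x, ∑' y, P x y ≤ 1 := fun x => ((hP1 x).tsum_eq).le
  have hQnn : ∀ k x w, 0 ≤ Q k x w := kpow_nonneg hP0 hQ0 hQ
  set C₁ : ℝ := c₂ * (3 ^ d + 2 * d * 3 ^ (d - 1) / (α - β)) with hC₁
  have hC₁nn : 0 ≤ C₁ := by
    rw [hC₁]
    have : 0 < α - β := by linarith
    positivity
  set g : (Fin d → ℤ) → ℝ := fun z => (1 + ‖z - x‖) ^ β with hg
  have hgnn : ∀ z, 0 ≤ g z := fun z => Real.rpow_nonneg (by positivity) _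
  have hstep := fun w => one_step_moment hd hP0 hP1 hub hc₂ hβ hβ1 hβα x w
  -- summability by induction on k
  have hsum : ∀ k, Summable fun z => Q k x z * g z := by
    intro k
    induction k with
    | zero =>
      have : (fun z => Q 0 x z * g z) = fun z => if z = x then g x else 0 := by
        funext z; rw [hQ0]
        by_cases h : z = x
        · rw [h]; simp
        · simp [h, Ne.symm h]
      rw [this]
      exact (hasSum_ite_eq x (g x)).summable
    | succ k ih =>
      -- Q (k+1) x u * g u = ∑' z, Q k x z * (P z u * g u); swap
      have hnn : ∀ z u, 0 ≤ Q k x z * (P z u * g u) := fun z u =>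
        mul_nonneg (hQnn k x z) (mul_nonneg (hP0 z u) (hgnn u))
      have h1 : ∀ z, Summable fun u => Q k x z * (P z u * g u) := fun z => (hstep z).1.mul_left _
      have h2 : Summable fun z => ∑' u, Q k x z * (P z u * g u) := by
        refine ((ih.add ((kpow_summable hP0 hPs hP1' hQ0 hQ k x).mul_right C₁))).of_nonneg_of_le
          (fun z => tsum_nonneg (hnn z)) (fun z => ?_)
        rw [tsum_mul_left]
        calc Q k x z * ∑' u, P z u * g u ≤ Q k x z * (g z + C₁) :=
              mul_le_mul_of_nonneg_left (hstep z).2 (hQnn k x z)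
          _ = Q k x z * g z + Q k x z * C₁ := by ring
      have hfun : (fun u => Q (k + 1) x u * g u) = fun u => ∑' z, Q k x z * (P z u * g u) := by
        funext u
        rw [hQ, ← tsum_mul_right]
        exact tsum_congr fun z => by ring
      rw [hfun]
      exact (summable_swap_of_nonneg hnn h1 h2).2
  refine ⟨hsum k, ?_⟩
  -- the one-step inequality for moments
  have hnn : ∀ z u, 0 ≤ Q k x z * (P z u * g u) := fun z u =>
    mul_nonneg (hQnn k x z) (mul_nonneg (hP0 z u) (hgnn u))
  have h1 : ∀ z, Summable fun u => Q k x z * (P z u * g u) := fun z => (hstep z).1.mul_left _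
  have hle : ∀ z, ∑' u, Q k x z * (P z u * g u) ≤ Q k x z * g z + Q k x z * C₁ := by
    intro z
    rw [tsum_mul_left]
    calc Q k x z * ∑' u, P z u * g u ≤ Q k x z * (g z + C₁) :=
          mul_le_mul_of_nonneg_left (hstep z).2 (hQnn k x z)
      _ = Q k x z * g z + Q k x z * C₁ := by ring
  have hmaj : Summable fun z => Q k x z * g z + Q k x z * C₁ :=
    (hsum k).add ((kpow_summable hP0 hPs hP1' hQ0 hQ k x).mul_right C₁)
  have h2 : Summable fun z => ∑' u, Q k x z * (P z u * g u) :=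
    hmaj.of_nonneg_of_le (fun z => tsum_nonneg (hnn z)) hle
  have hfun : (fun u => Q (k + 1) x u * g u) = fun u => ∑' z, Q k x z * (P z u * g u) := by
    funext u
    rw [hQ, ← tsum_mul_right]
    exact tsum_congr fun z => by ring
  calc ∑' u, Q (k + 1) x u * g u = ∑' u, ∑' z, Q k x z * (P z u * g u) := by rw [hfun]
    _ = ∑' z, ∑' u, Q k x z * (P z u * g u) := tsum_swap_of_nonneg hnn h1 h2
    _ ≤ ∑' z, (Q k x z * g z + Q k x z * C₁) := Summable.tsum_le_tsum hle h2 hmaj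
    _ = ∑' z, Q k x z * g z + (∑' z, Q k x z) * C₁ := by
        rw [Summable.tsum_add (hsum k) ((kpow_summable hP0 hPs hP1' hQ0 hQ k x).mul_right C₁),
          tsum_mul_right]
    _ ≤ ∑' z, Q k x z * g z + 1 * C₁ := by
        have := kpow_tsum_le_one hP0 hPs hP1' hQ0 hQ k x
        nlinarith
    _ = ∑' z, Q k x z * g z + C₁ := by rw [one_mul]

/-- A priori linear growth of the moments: `M(k) ≤ 1 + k C₁`. [folklore] -/
theorem kpow_moment_le_linear (hd : 1 ≤ d) (hP0 : ∀ x y, 0 ≤ P x y) (hP1 : ∀ x, HasSum (P x) 1)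
    (hub : ∀ x y, P x y ≤ c₂ * ‖x - y‖ ^ (-((d : ℝ) + α))) (hc₂ : 0 ≤ c₂)
    (hQ0 : ∀ x y, Q 0 x y = if x = y then 1 else 0)
    (hQ : ∀ n x y, Q (n + 1) x y = ∑' z, Q n x z * P z y)
    {β : ℝ} (hβ : 0 < β) (hβ1 : β ≤ 1) (hβα : β < α) (x : Fin d → ℤ) (k : ℕ) :
    ∑' z, Q k x z * (1 + ‖z - x‖) ^ β ≤ 1 + k * (c₂ * (3 ^ d + 2 * d * 3 ^ (d - 1) / (α - β))) := by
  induction k with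
  | zero =>
    have : (fun z => Q 0 x z * (1 + ‖z - x‖) ^ β) =
        fun z => if z = x then (1 + ‖z - x‖) ^ β else 0 := by
      funext z; rw [hQ0]
      by_cases h : x = z
      · subst h; simp
      · simp [h, Ne.symm h]
    rw [this, tsum_ite_eq]
    simp
  | succ k ih =>
    have := (kpow_moment_summable hd hP0 hP1 hub hc₂ hQ0 hQ hβ hβ1 hβα x k).2
    push_cast
    linarith

/-! ### The two-step kernel from above -/

/-- **Two-step upper bound**: for a reversible kernel with weights in `[m, M]` and
`P x y ≤ c₂ ‖x−y‖^{-(d+α)}`, off the diagonal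
`Q 2 y z ≤ c₂ 2^{d+α} (M/m + 1) ‖y−z‖^{-(d+α)}`. [folklore] -/
theorem kpow_two_upper (hP0 : ∀ x y, 0 ≤ P x y) (hP1 : ∀ x, HasSum (P x) 1)
    (hμ : ∀ x, m ≤ μ x ∧ μ x ≤ M) (hm : 0 < m)
    (hrev : ∀ x y, μ x * P x y = μ y * P y x)
    (hub : ∀ x y, P x y ≤ c₂ * ‖x - y‖ ^ (-((d : ℝ) + α))) (hc₂ : 0 ≤ c₂) (hαd : 0 ≤ (d : ℝ) + α)
    (hQ0 : ∀ x y, Q 0 x y = if x = y then 1 else 0)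
    (hQ : ∀ n x y, Q (n + 1) x y = ∑' z, Q n x z * P z y) {y z : Fin d → ℤ} (hyz : y ≠ z) :
    Q 2 y z ≤ c₂ * (2 : ℝ) ^ ((d : ℝ) + α) * (M / m + 1) * ‖y - z‖ ^ (-((d : ℝ) + α)) := by
  have hPs : ∀ x, Summable (P x) := fun x => (hP1 x).summable
  have hP1' : ∀ x, ∑' y, P x y ≤ 1 := fun x => ((hP1 x).tsum_eq).le
  have hμpos : ∀ x, 0 < μ x := fun x => lt_of_lt_of_le hm (hμ x).1
  have hM : 0 < M := lt_of_lt_of_le hm ((hμ y).1.trans (hμ y).2)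
  set s : ℝ := (d : ℝ) + α with hs
  set R : ℝ := ‖y - z‖ with hR
  have hRpos : 0 < R := norm_pos_iff.mpr (sub_ne_zero.mpr hyz)
  have hR2 : 0 < R / 2 := by positivity
  set K : ℝ := c₂ * (R / 2) ^ (-s) with hK
  have hKnn : 0 ≤ K := by rw [hK]; positivity
  -- pointwise: P y w * P w z ≤ K * (P w z + P y w)
  have hpt : ∀ w, P y w * P w z ≤ K * (P w z + P y w) := by
    intro w
    rcases le_or_gt (R / 2) ‖y - w‖ with h1 | h1
    · -- the first jump is long
      have hyw : 0 < ‖y - w‖ := lt_of_lt_of_le hR2 h1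
      have hb : P y w ≤ K := by
        calc P y w ≤ c₂ * ‖y - w‖ ^ (-s) := hub y w
          _ ≤ c₂ * (R / 2) ^ (-s) := mul_le_mul_of_nonneg_left
              (Real.rpow_le_rpow_of_nonpos hR2 h1 (by linarith)) hc₂
      calc P y w * P w z ≤ K * P w z := mul_le_mul_of_nonneg_right hb (hP0 w z)
        _ ≤ K * (P w z + P y w) := by nlinarith [hP0 y w]
    · -- the second jump is long
      have h2 : R / 2 ≤ ‖w - z‖ := by
        have : R ≤ ‖y - w‖ + ‖w - z‖ := by
          calc R = ‖(y - w) + (w - z)‖ := by rw [hR]; congr 1; abel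
            _ ≤ ‖y - w‖ + ‖w - z‖ := norm_add_le _ _
        linarith
      have hwz : 0 < ‖w - z‖ := lt_of_lt_of_le hR2 h2
      have hb : P w z ≤ K := by
        calc P w z ≤ c₂ * ‖w - z‖ ^ (-s) := hub w z
          _ ≤ c₂ * (R / 2) ^ (-s) := mul_le_mul_of_nonneg_left
              (Real.rpow_le_rpow_of_nonpos hR2 h2 (by linarith)) hc₂
      calc P y w * P w z ≤ P y w * K := mul_le_mul_of_nonneg_left hb (hP0 y w)
        _ ≤ K * (P w z + P y w) := by nlinarith [hP0 w z]
  -- column sum bound ∑_w P w z ≤ M/m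
  have hcol : (Summable fun w => P w z) ∧ ∑' w, P w z ≤ M / m := by
    have hrel : ∀ w, P w z ≤ (M / m) * P z w := by
      intro w
      have : P w z = (μ z / μ w) * P z w := by
        rw [div_mul_eq_mul_div, eq_div_iff (hμpos w).ne']
        calc P w z * μ w = μ w * P w z := mul_comm _ _
          _ = μ z * P z w := hrev w z
      rw [this]
      exact mul_le_mul_of_nonneg_right (div_le_div₀ hM.le (hμ z).2 hm (hμ w).1) (hP0 z w)
    have hs : Summable fun w => P w z := ((hPs z).mul_left (M / m)).of_nonneg_of_le (hP0 · z) hrel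
    refine ⟨hs, ?_⟩
    calc ∑' w, P w z ≤ ∑' w, (M / m) * P z w := Summable.tsum_le_tsum hrel hs ((hPs z).mul_left _)
      _ = (M / m) * ∑' w, P z w := tsum_mul_left
      _ = M / m := by rw [(hP1 z).tsum_eq, mul_one]
  have h2K : (R / 2) ^ (-s) = (2 : ℝ) ^ s * R ^ (-s) := by
    rw [Real.div_rpow hRpos.le (by norm_num), Real.rpow_neg (by norm_num : (0 : ℝ) ≤ 2),
      div_inv_eq_mul, mul_comm]
  calc Q 2 y z = ∑' w, Q 1 y w * Q 1 w z := kpow_add hP0 hPs hP1' hQ0 hQ 1 1 y z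
    _ = ∑' w, P y w * P w z := tsum_congr fun w => by rw [kpow_one hQ0 hQ, kpow_one hQ0 hQ]
    _ ≤ ∑' w, K * (P w z + P y w) :=
        Summable.tsum_le_tsum hpt (by
          have := summable_kpow_mul_kpow hP0 hPs hP1' hQ0 hQ 1 1 y z
          exact this.congr (fun w => by rw [kpow_one hQ0 hQ, kpow_one hQ0 hQ]))
          ((hcol.1.add (hPs y)).mul_left K)
    _ = K * (∑' w, P w z + ∑' w, P y w) := by rw [tsum_mul_left, Summable.tsum_add hcol.1 (hPs y)]
    _ ≤ K * (M / m + 1) := by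
        rw [(hP1 y).tsum_eq]
        exact mul_le_mul_of_nonneg_left (add_le_add hcol.2 le_rfl) hKnn
    _ = c₂ * (2 : ℝ) ^ s * (M / m + 1) * R ^ (-s) := by rw [hK, h2K]; ring

/-! ### The carré du champ of `(1+‖·−x‖)^β` -/

/-- One-sided mean-value bound for concave powers: for `0 < a ≤ b`, `0 < β ≤ 1`,
`b^β − a^β ≤ β a^{β−1} (b − a)`. [folklore] -/
theorem rpow_sub_rpow_le_of_le {a b β : ℝ} (ha : 0 < a) (hab : a ≤ b) (hβ : 0 < β) (hβ1 : β ≤ 1) :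
    b ^ β - a ^ β ≤ β * a ^ (β - 1) * (b - a) := by
  have hba : b = a * (1 + (b / a - 1)) := by field_simp; ring
  have hs : (-1 : ℝ) ≤ b / a - 1 := by
    have : 0 ≤ b / a := div_nonneg (ha.le.trans hab) ha.le
    linarith
  have hbern := rpow_one_add_le_one_add_mul_self hs hβ.le hβ1
  have h1 : b ^ β ≤ a ^ β * (1 + β * (b / a - 1)) := by
    calc b ^ β = (a * (1 + (b / a - 1))) ^ β := by rw [← hba]
      _ = a ^ β * (1 + (b / a - 1)) ^ β := Real.mul_rpow ha.le (by linarith)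
      _ ≤ a ^ β * (1 + β * (b / a - 1)) := mul_le_mul_of_nonneg_left hbern (Real.rpow_nonneg ha.le _)
  have h2 : a ^ β * (1 + β * (b / a - 1)) = a ^ β + β * a ^ (β - 1) * (b - a) := by
    rw [Real.rpow_sub_one ha.ne']
    field_simp
  linarith

/-- Mean-value bound for concave powers: `|a^β − b^β| ≤ β (min a b)^{β−1} |a − b|` for
`a, b > 0`, `0 < β ≤ 1`. [folklore] -/
theorem abs_rpow_sub_rpow_le {a b β : ℝ} (ha : 0 < a) (hb : 0 < b) (hβ : 0 < β) (hβ1 : β ≤ 1) :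
    |a ^ β - b ^ β| ≤ β * (min a b) ^ (β - 1) * |a - b| := by
  rcases le_total a b with hab | hab
  · rw [min_eq_left hab]
    have h := rpow_sub_rpow_le_of_le ha hab hβ hβ1
    have hmono : a ^ β ≤ b ^ β := Real.rpow_le_rpow ha.le hab hβ.le
    rw [abs_of_nonpos (by linarith), abs_of_nonpos (by linarith)]
    linarith
  · rw [min_eq_right hab]
    have h := rpow_sub_rpow_le_of_le hb hab hβ hβ1
    have hmono : b ^ β ≤ a ^ β := Real.rpow_le_rpow hb.le hab hβ.le
    rw [abs_of_nonneg (by linarith), abs_of_nonneg (by linarith)]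
    linarith

/-- Pointwise estimate for the carré du champ of `(1+‖·−x‖)^β`: with `D = 1+‖y−x‖`,
`r = ⌊D/2⌋`, a weight `q ≤ C₂ ‖z−y‖^{-s}` (`z ≠ y`) satisfies
`q (D^β − (1+‖z−x‖)^β)² ≤ Fnear(z−y) + Ffar(z−y)` with the explicit majorants of the statement
(near: `‖h‖ ≤ r`, mean value theorem; far: `‖h‖ > r`, crude bound). [folklore] -/
theorem gamma_term_le {s β C₂ : ℝ} (hβ : 0 < β) (hβ1 : β ≤ 1) (hC₂ : 0 ≤ C₂)
    (x y z : Fin d → ℤ) {q : ℝ} (hq : z ≠ y → q ≤ C₂ * ‖z - y‖ ^ (-s)) :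
    q * ((1 + ‖y - x‖) ^ β - (1 + ‖z - x‖) ^ β) ^ 2 ≤
      (if z - y ≠ 0 ∧ ‖z - y‖ ≤ (⌊(1 + ‖y - x‖) / 2⌋₊ : ℝ) then
          C₂ * β ^ 2 * ((1 + ‖y - x‖) / 2) ^ (2 * β - 2) * ‖z - y‖ ^ (2 - s) else 0) +
      (if (⌊(1 + ‖y - x‖) / 2⌋₊ : ℝ) < ‖z - y‖ then
          C₂ * (2 * (4 : ℝ) ^ β + 2 * (9 : ℝ) ^ β) * ‖z - y‖ ^ (-(s - 2 * β)) else 0) := by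
  have hD1 : 1 ≤ 1 + ‖y - x‖ := by linarith [norm_nonneg (y - x)]
  have hDpos : 0 < 1 + ‖y - x‖ := by linarith
  have hddpos : 0 < 1 + ‖z - x‖ := by linarith [norm_nonneg (z - x)]
  have hnear_nn : 0 ≤ (if z - y ≠ 0 ∧ ‖z - y‖ ≤ (⌊(1 + ‖y - x‖) / 2⌋₊ : ℝ) then
      C₂ * β ^ 2 * ((1 + ‖y - x‖) / 2) ^ (2 * β - 2) * ‖z - y‖ ^ (2 - s) else 0) := by
    split_ifs
    · positivity
    · exact le_rfl
  have hfar_nn : 0 ≤ (if (⌊(1 + ‖y - x‖) / 2⌋₊ : ℝ) < ‖z - y‖ then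
      C₂ * (2 * (4 : ℝ) ^ β + 2 * (9 : ℝ) ^ β) * ‖z - y‖ ^ (-(s - 2 * β)) else 0) := by
    split_ifs
    · positivity
    · exact le_rfl
  by_cases hzy : z = y
  · subst hzy
    rw [sub_self, zero_pow two_ne_zero, mul_zero]
    exact add_nonneg hnear_nn hfar_nn
  have hh0 : z - y ≠ 0 := sub_ne_zero.mpr hzy
  have hhpos : 0 < ‖z - y‖ := norm_pos_iff.mpr hh0
  have hq' := hq hzy
  -- |D - dd z| ≤ ‖z - y‖
  have hdiff : |(1 + ‖y - x‖) - (1 + ‖z - x‖)| ≤ ‖z - y‖ := by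
    have : (1 + ‖y - x‖) - (1 + ‖z - x‖) = ‖y - x‖ - ‖z - x‖ := by ring
    rw [this]
    calc |‖y - x‖ - ‖z - x‖| ≤ ‖(y - x) - (z - x)‖ := abs_norm_sub_norm_le _ _
      _ = ‖z - y‖ := by rw [show (y - x) - (z - x) = y - z by abel, norm_sub_rev]
  rcases le_or_gt ‖z - y‖ (⌊(1 + ‖y - x‖) / 2⌋₊ : ℝ) with hnear | hfar
  · -- near
    rw [if_pos ⟨hh0, hnear⟩]
    have hhD : ‖z - y‖ ≤ (1 + ‖y - x‖) / 2 := hnear.trans (Nat.floor_le (by positivity))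
    have hmin : (1 + ‖y - x‖) / 2 ≤ min (1 + ‖y - x‖) (1 + ‖z - x‖) := by
      refine le_min (by linarith) ?_
      have := abs_le.mp hdiff; linarith
    have hmv := abs_rpow_sub_rpow_le hDpos hddpos hβ hβ1
    have hminpow : (min (1 + ‖y - x‖) (1 + ‖z - x‖)) ^ (β - 1) ≤ ((1 + ‖y - x‖) / 2) ^ (β - 1) :=
      Real.rpow_le_rpow_of_nonpos (by positivity) hmin (by linarith)
    have habs : |(1 + ‖y - x‖) ^ β - (1 + ‖z - x‖) ^ β| ≤
        β * ((1 + ‖y - x‖) / 2) ^ (β - 1) * ‖z - y‖ :=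
      hmv.trans (mul_le_mul (mul_le_mul_of_nonneg_left hminpow hβ.le) hdiff (abs_nonneg _)
        (by positivity))
    have hsq : ((1 + ‖y - x‖) ^ β - (1 + ‖z - x‖) ^ β) ^ 2 ≤
        β ^ 2 * ((1 + ‖y - x‖) / 2) ^ (2 * β - 2) * ‖z - y‖ ^ 2 := by
      have hpow2 : (((1 + ‖y - x‖) / 2) ^ (β - 1)) ^ 2 = ((1 + ‖y - x‖) / 2) ^ (2 * β - 2) := by
        rw [← Real.rpow_natCast, ← Real.rpow_mul (by positivity)]
        congr 1; push_cast; ring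
      calc ((1 + ‖y - x‖) ^ β - (1 + ‖z - x‖) ^ β) ^ 2
          = |(1 + ‖y - x‖) ^ β - (1 + ‖z - x‖) ^ β| ^ 2 := (sq_abs _).symm
        _ ≤ (β * ((1 + ‖y - x‖) / 2) ^ (β - 1) * ‖z - y‖) ^ 2 := pow_le_pow_left₀ (abs_nonneg _) habs 2
        _ = β ^ 2 * (((1 + ‖y - x‖) / 2) ^ (β - 1)) ^ 2 * ‖z - y‖ ^ 2 := by ring
        _ = β ^ 2 * ((1 + ‖y - x‖) / 2) ^ (2 * β - 2) * ‖z - y‖ ^ 2 := by rw [hpow2]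
    calc q * ((1 + ‖y - x‖) ^ β - (1 + ‖z - x‖) ^ β) ^ 2
        ≤ (C₂ * ‖z - y‖ ^ (-s)) * (β ^ 2 * ((1 + ‖y - x‖) / 2) ^ (2 * β - 2) * ‖z - y‖ ^ 2) :=
          mul_le_mul hq' hsq (sq_nonneg _) (by positivity)
      _ = C₂ * β ^ 2 * ((1 + ‖y - x‖) / 2) ^ (2 * β - 2) * (‖z - y‖ ^ (-s) * ‖z - y‖ ^ ((2 : ℕ) : ℝ)) := by
          rw [Real.rpow_natCast]; ring
      _ = C₂ * β ^ 2 * ((1 + ‖y - x‖) / 2) ^ (2 * β - 2) * ‖z - y‖ ^ (2 - s) := by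
          rw [← Real.rpow_add hhpos]; congr 2; push_cast; ring
      _ ≤ _ := le_add_of_nonneg_right hfar_nn
  · -- far
    rw [if_pos hfar]
    have hhD : (1 + ‖y - x‖) / 2 < ‖z - y‖ := by
      have h1 := Nat.lt_floor_add_one ((1 + ‖y - x‖) / 2)
      obtain ⟨k, hk⟩ := exists_norm_eq_natCast (z - y)
      rw [hk] at hfar ⊢
      have hrk : ⌊(1 + ‖y - x‖) / 2⌋₊ + 1 ≤ k := by exact_mod_cast hfar
      calc (1 + ‖y - x‖) / 2 < (⌊(1 + ‖y - x‖) / 2⌋₊ : ℝ) + 1 := h1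
        _ = ((⌊(1 + ‖y - x‖) / 2⌋₊ + 1 : ℕ) : ℝ) := by push_cast; ring
        _ ≤ k := by exact_mod_cast hrk
    have hDle : 1 + ‖y - x‖ ≤ 2 * ‖z - y‖ := by linarith
    have hddle : 1 + ‖z - x‖ ≤ 3 * ‖z - y‖ := by
      have := abs_le.mp hdiff; linarith
    have hsqpow : ∀ {w : ℝ}, 0 ≤ w → (w ^ β) ^ 2 = w ^ (2 * β) := by
      intro w hw
      rw [← Real.rpow_natCast, ← Real.rpow_mul hw]; congr 1; push_cast; ring
    have h2 : ((1 + ‖y - x‖) ^ β) ^ 2 ≤ (4 : ℝ) ^ β * ‖z - y‖ ^ (2 * β) := by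
      calc ((1 + ‖y - x‖) ^ β) ^ 2 = (1 + ‖y - x‖) ^ (2 * β) := hsqpow hDpos.le
        _ ≤ (2 * ‖z - y‖) ^ (2 * β) := Real.rpow_le_rpow hDpos.le hDle (by positivity)
        _ = (2 : ℝ) ^ (2 * β) * ‖z - y‖ ^ (2 * β) := Real.mul_rpow (by norm_num) (norm_nonneg _)
        _ = (4 : ℝ) ^ β * ‖z - y‖ ^ (2 * β) := by
            congr 1; rw [Real.rpow_mul (by norm_num)]; norm_num
    have h3 : ((1 + ‖z - x‖) ^ β) ^ 2 ≤ (9 : ℝ) ^ β * ‖z - y‖ ^ (2 * β) := by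
      calc ((1 + ‖z - x‖) ^ β) ^ 2 = (1 + ‖z - x‖) ^ (2 * β) := hsqpow hddpos.le
        _ ≤ (3 * ‖z - y‖) ^ (2 * β) := Real.rpow_le_rpow hddpos.le hddle (by positivity)
        _ = (3 : ℝ) ^ (2 * β) * ‖z - y‖ ^ (2 * β) := Real.mul_rpow (by norm_num) (norm_nonneg _)
        _ = (9 : ℝ) ^ β * ‖z - y‖ ^ (2 * β) := by
            congr 1; rw [Real.rpow_mul (by norm_num)]; norm_num
    have hsq : ((1 + ‖y - x‖) ^ β - (1 + ‖z - x‖) ^ β) ^ 2 ≤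
        (2 * (4 : ℝ) ^ β + 2 * (9 : ℝ) ^ β) * ‖z - y‖ ^ (2 * β) := by
      have h1 : ((1 + ‖y - x‖) ^ β - (1 + ‖z - x‖) ^ β) ^ 2 ≤
          2 * ((1 + ‖y - x‖) ^ β) ^ 2 + 2 * ((1 + ‖z - x‖) ^ β) ^ 2 := by
        nlinarith [sq_nonneg ((1 + ‖y - x‖) ^ β + (1 + ‖z - x‖) ^ β)]
      calc _ ≤ 2 * ((1 + ‖y - x‖) ^ β) ^ 2 + 2 * ((1 + ‖z - x‖) ^ β) ^ 2 := h1
        _ ≤ 2 * ((4 : ℝ) ^ β * ‖z - y‖ ^ (2 * β)) + 2 * ((9 : ℝ) ^ β * ‖z - y‖ ^ (2 * β)) := by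
            linarith
        _ = (2 * (4 : ℝ) ^ β + 2 * (9 : ℝ) ^ β) * ‖z - y‖ ^ (2 * β) := by ring
    calc q * ((1 + ‖y - x‖) ^ β - (1 + ‖z - x‖) ^ β) ^ 2
        ≤ (C₂ * ‖z - y‖ ^ (-s)) * ((2 * (4 : ℝ) ^ β + 2 * (9 : ℝ) ^ β) * ‖z - y‖ ^ (2 * β)) :=
          mul_le_mul hq' hsq (sq_nonneg _) (by positivity)
      _ = C₂ * (2 * (4 : ℝ) ^ β + 2 * (9 : ℝ) ^ β) * (‖z - y‖ ^ (-s) * ‖z - y‖ ^ (2 * β)) := by ring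
      _ = C₂ * (2 * (4 : ℝ) ^ β + 2 * (9 : ℝ) ^ β) * ‖z - y‖ ^ (-(s - 2 * β)) := by
          rw [← Real.rpow_add hhpos]; congr 2; ring
      _ ≤ _ := le_add_of_nonneg_left hnear_nn

/-- Sum of the near majorant: `∑_{0<‖h‖≤r} A ‖h‖^{2−s} ≤ A L r^{d+2−s}` (finitely supported,
lattice inner-sum bound). [folklore] -/
theorem near_majorant_tsum_le (hd : 1 ≤ d) {s A : ℝ} (hγ : -(d : ℝ) < 2 - s) (hA : 0 ≤ A) (r : ℕ)
    (F : (Fin d → ℤ) → ℝ) (hF : ∀ h, F h = if h ≠ 0 ∧ ‖h‖ ≤ r then A * ‖h‖ ^ (2 - s) else 0) :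
    Summable F ∧ ∑' h, F h ≤
        A * (2 * d * 3 ^ (d - 1) * (1 + 1 / (d + (2 - s)))) * (r : ℝ) ^ ((d : ℝ) + (2 - s)) := by
  set B : Finset (Fin d → ℤ) := Fintype.piFinset (fun _ : Fin d => Finset.Icc (-(r : ℤ)) r) with hB
  have hsupp : ∀ h, h ∉ B → F h = 0 := by
    intro h hh
    rw [hF, if_neg]
    intro hc
    exact hh ((mem_box_iff h r).mpr hc.2)
  refine ⟨summable_of_ne_finset_zero hsupp, ?_⟩
  rw [tsum_eq_sum hsupp]
  have h0 : (0 : Fin d → ℤ) ∈ B := (mem_box_iff 0 r).mpr (by simp)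
  rw [← Finset.add_sum_erase B _ h0]
  have hz : F 0 = 0 := by rw [hF]; simp
  rw [hz, zero_add]
  have heq : ∀ h ∈ B.erase 0, F h = A * ‖h‖ ^ (2 - s) := by
    intro h hh
    have hh' := Finset.mem_erase.mp hh
    rw [hF, if_pos ⟨hh'.1, (mem_box_iff h r).mp hh'.2⟩]
  rw [Finset.sum_congr rfl heq, ← Finset.mul_sum, mul_assoc]
  refine mul_le_mul_of_nonneg_left ?_ hA
  exact sum_norm_rpow_le_of_norm_le hd hγ r (B.erase 0) (fun h hh => by
    have hh' := Finset.mem_erase.mp hh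
    exact ⟨hh'.1, (mem_box_iff h r).mp hh'.2⟩)

/-- Sum of the far majorant: `∑_{‖h‖>r} A ‖h‖^{-t}` is at most `A Z_t` always, and at most
`A L r^{d−t}` when `r ≥ 1` (`t > d`). [folklore] -/
theorem far_majorant_tsum_le (hd : 1 ≤ d) {t A : ℝ} (ht : (d : ℝ) < t) (hA : 0 ≤ A) (r : ℕ)
    (F : (Fin d → ℤ) → ℝ) (hF : ∀ h, F h = if (r : ℝ) < ‖h‖ then A * ‖h‖ ^ (-t) else 0) :
    Summable F ∧ ∑' h, F h ≤ A * (3 ^ d + 2 * d * 3 ^ (d - 1) / (t - d)) ∧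
      (1 ≤ r → ∑' h, F h ≤ A * (2 * d * 3 ^ (d - 1) / (t - d)) * (r : ℝ) ^ ((d : ℝ) - t)) := by
  obtain ⟨hZs, hZle⟩ := summable_norm_rpow_neg hd ht
  have hnn : ∀ h : Fin d → ℤ, 0 ≤ F h := by
    intro h; rw [hF]; split_ifs
    · positivity
    · exact le_rfl
  have hne_of : ∀ h : Fin d → ℤ, (r : ℝ) < ‖h‖ → h ≠ 0 := by
    intro h hc h0; rw [h0, norm_zero] at hc; exact (not_lt.mpr (Nat.cast_nonneg r)) hc
  have hdom : ∀ h : Fin d → ℤ, F h ≤ A * (if h = 0 then (0 : ℝ) else ‖h‖ ^ (-t)) := by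
    intro h
    rw [hF]
    by_cases hc : (r : ℝ) < ‖h‖
    · rw [if_pos hc, if_neg (hne_of h hc)]
    · rw [if_neg hc]
      refine mul_nonneg hA ?_
      split_ifs
      · exact le_rfl
      · exact Real.rpow_nonneg (norm_nonneg _) _
  have hs : Summable F := (hZs.mul_left A).of_nonneg_of_le hnn hdom
  refine ⟨hs, ?_, ?_⟩
  · calc _ ≤ ∑' h : Fin d → ℤ, A * (if h = 0 then (0 : ℝ) else ‖h‖ ^ (-t)) :=
          Summable.tsum_le_tsum hdom hs (hZs.mul_left A)
      _ = A * ∑' h : Fin d → ℤ, (if h = 0 then (0 : ℝ) else ‖h‖ ^ (-t)) := tsum_mul_left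
      _ ≤ A * (3 ^ d + 2 * d * 3 ^ (d - 1) / (t - d)) := mul_le_mul_of_nonneg_left hZle hA
  · intro hr
    refine Real.tsum_le_of_sum_le hnn (fun u => ?_)
    classical
    have hsplit : ∑ h ∈ u, F h = A * ∑ h ∈ u.filter (fun h => (r : ℝ) < ‖h‖), ‖h‖ ^ (-t) := by
      rw [Finset.mul_sum, Finset.sum_filter]
      exact Finset.sum_congr rfl fun h _ => hF h
    rw [hsplit, mul_assoc]
    refine mul_le_mul_of_nonneg_left ?_ hA
    exact sum_norm_rpow_le_of_norm_gt hd ht hr (u.filter (fun h => (r : ℝ) < ‖h‖))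
      (fun h hh => (Finset.mem_filter.mp hh).2)

/-- **Carré du champ bound.** For a Markov kernel `P` on `ℤ^d` (`d ≥ 1`), reversible with
weights in `[m, M]`, with `P x y ≤ c₂ ‖x−y‖^{-(d+α)}`, `0 < α < 2`, and `0 < β` with
`2β < α`, `β ≤ 1`: there is `C` such that for all `x, y`,
`∑_z Q 2 y z ((1+‖y−x‖)^β − (1+‖z−x‖)^β)² ≤ C (1+‖y−x‖)^{2β−α}` (and the family is summable).
[folklore] -/
theorem gamma_bound (hd : 1 ≤ d) (hα : 0 < α) (hα2 : α < 2) (hP0 : ∀ x y, 0 ≤ P x y)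
    (hP1 : ∀ x, HasSum (P x) 1)
    (hμ : ∀ x, m ≤ μ x ∧ μ x ≤ M) (hm : 0 < m)
    (hrev : ∀ x y, μ x * P x y = μ y * P y x)
    (hub : ∀ x y, P x y ≤ c₂ * ‖x - y‖ ^ (-((d : ℝ) + α))) (hc₂ : 0 ≤ c₂)
    (hQ0 : ∀ x y, Q 0 x y = if x = y then 1 else 0)
    (hQ : ∀ n x y, Q (n + 1) x y = ∑' z, Q n x z * P z y)
    {β : ℝ} (hβ : 0 < β) (hβ1 : β ≤ 1) (h2β : 2 * β < α) :
    ∃ C : ℝ, 0 < C ∧ ∀ x y : Fin d → ℤ,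
      (Summable fun z => Q 2 y z * ((1 + ‖y - x‖) ^ β - (1 + ‖z - x‖) ^ β) ^ 2) ∧
      ∑' z, Q 2 y z * ((1 + ‖y - x‖) ^ β - (1 + ‖z - x‖) ^ β) ^ 2 ≤
        C * (1 + ‖y - x‖) ^ (2 * β - α) := by
  have hQnn : ∀ k x w, 0 ≤ Q k x w := kpow_nonneg hP0 hQ0 hQ
  have hsd : 0 ≤ (d : ℝ) + α := by positivity
  have hM : 0 < M := lt_of_lt_of_le hm ((hμ 0).1.trans (hμ 0).2)
  -- constants
  have hC₂nn : 0 ≤ c₂ * (2 : ℝ) ^ ((d : ℝ) + α) * (M / m + 1) := by positivity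
  have hγnear : -(d : ℝ) < 2 - ((d : ℝ) + α) := by linarith
  have htfar : (d : ℝ) < ((d : ℝ) + α) - 2 * β := by linarith
  have hcfar : 0 < 2 * (4 : ℝ) ^ β + 2 * (9 : ℝ) ^ β := by positivity
  have hLn : 0 < 2 * (d : ℝ) * 3 ^ (d - 1) * (1 + 1 / (d + (2 - ((d : ℝ) + α)))) := by
    have : 0 < (d : ℝ) + (2 - ((d : ℝ) + α)) := by linarith
    have : (0 : ℝ) < d := by exact_mod_cast hd
    positivity
  have hLf : 0 ≤ 2 * (d : ℝ) * 3 ^ (d - 1) / (((d : ℝ) + α) - 2 * β - d) := by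
    have : 0 < ((d : ℝ) + α) - 2 * β - d := by linarith
    positivity
  have hZt : 0 ≤ 3 ^ d + 2 * (d : ℝ) * 3 ^ (d - 1) / (((d : ℝ) + α) - 2 * β - d) := by
    have : 0 < ((d : ℝ) + α) - 2 * β - d := by linarith
    positivity
  -- near coefficient Kn, far coefficient Kf
  obtain ⟨Kn, hKn, hKn_def⟩ : ∃ Kn : ℝ, 0 ≤ Kn ∧ Kn = (c₂ * (2 : ℝ) ^ ((d : ℝ) + α) * (M / m + 1)) *
      β ^ 2 * (2 * (d : ℝ) * 3 ^ (d - 1) * (1 + 1 / (d + (2 - ((d : ℝ) + α))))) * (2 : ℝ) ^ (α - 2 * β) :=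
    ⟨_, by positivity, rfl⟩
  obtain ⟨Kf, hKf, hKf_def⟩ : ∃ Kf : ℝ, 0 ≤ Kf ∧ Kf = (c₂ * (2 : ℝ) ^ ((d : ℝ) + α) * (M / m + 1)) *
      (2 * (4 : ℝ) ^ β + 2 * (9 : ℝ) ^ β) *
      ((2 * (d : ℝ) * 3 ^ (d - 1) / (((d : ℝ) + α) - 2 * β - d)) * (4 : ℝ) ^ (α - 2 * β) +
        (3 ^ d + 2 * (d : ℝ) * 3 ^ (d - 1) / (((d : ℝ) + α) - 2 * β - d)) * (4 : ℝ) ^ (α - 2 * β)) :=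
    ⟨_, by positivity, rfl⟩
  refine ⟨Kn + Kf + 1, by positivity, fun x y => ?_⟩
  -- abbreviations
  have hD1 : 1 ≤ 1 + ‖y - x‖ := by linarith [norm_nonneg (y - x)]
  have hDpos : 0 < 1 + ‖y - x‖ := by linarith
  have hq : ∀ z, z ≠ y → Q 2 y z ≤ (c₂ * (2 : ℝ) ^ ((d : ℝ) + α) * (M / m + 1)) * ‖z - y‖ ^ (-((d : ℝ) + α)) := by
    intro z hzy
    have := kpow_two_upper hP0 hP1 hμ hm hrev hub hc₂ hsd hQ0 hQ (Ne.symm hzy)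
    rwa [norm_sub_rev] at this
  have hpt := fun z => gamma_term_le (s := (d : ℝ) + α) hβ hβ1 hC₂nn x y z (hq z)
  -- the majorants as functions of h, introduced as opaque local functions
  obtain ⟨Fn, hFn⟩ : ∃ Fn : (Fin d → ℤ) → ℝ, ∀ h, Fn h =
      if h ≠ 0 ∧ ‖h‖ ≤ (⌊(1 + ‖y - x‖) / 2⌋₊ : ℝ) then
        (c₂ * (2 : ℝ) ^ ((d : ℝ) + α) * (M / m + 1)) * β ^ 2 * ((1 + ‖y - x‖) / 2) ^ (2 * β - 2) *
          ‖h‖ ^ (2 - ((d : ℝ) + α)) else 0 := ⟨_, fun h => rfl⟩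
  obtain ⟨Ff, hFf⟩ : ∃ Ff : (Fin d → ℤ) → ℝ, ∀ h, Ff h =
      if (⌊(1 + ‖y - x‖) / 2⌋₊ : ℝ) < ‖h‖ then
        (c₂ * (2 : ℝ) ^ ((d : ℝ) + α) * (M / m + 1)) * (2 * (4 : ℝ) ^ β + 2 * (9 : ℝ) ^ β) *
          ‖h‖ ^ (-(((d : ℝ) + α) - 2 * β)) else 0 := ⟨_, fun h => rfl⟩
  obtain ⟨hns, hnle⟩ := near_majorant_tsum_le hd hγnear (by positivity) (⌊(1 + ‖y - x‖) / 2⌋₊) Fn hFn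
  obtain ⟨hfs, hfle0, hfle1⟩ := far_majorant_tsum_le hd htfar (by positivity) (⌊(1 + ‖y - x‖) / 2⌋₊) Ff hFf
  have hpt' : ∀ z, Q 2 y z * ((1 + ‖y - x‖) ^ β - (1 + ‖z - x‖) ^ β) ^ 2 ≤ Fn (z - y) + Ff (z - y) := by
    intro z; rw [hFn (z - y), hFf (z - y)]; exact hpt z
  have hmaj_s : Summable fun z : Fin d → ℤ => Fn (z - y) + Ff (z - y) :=
    (Equiv.subRight y).summable_iff.mpr (hns.add hfs)
  have hsum_z : Summable fun z => Q 2 y z * ((1 + ‖y - x‖) ^ β - (1 + ‖z - x‖) ^ β) ^ 2 :=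
    hmaj_s.of_nonneg_of_le (fun z => mul_nonneg (hQnn 2 y z) (sq_nonneg _)) hpt'
  refine ⟨hsum_z, ?_⟩
  -- bound the two majorant sums by multiples of D^{2β-α}, D = 1 + ‖y - x‖
  have hDe : 0 ≤ (1 + ‖y - x‖) ^ (2 * β - α) := Real.rpow_nonneg hDpos.le _
  have h4nn : 0 ≤ (4 : ℝ) ^ (α - 2 * β) := Real.rpow_nonneg (by norm_num) _
  have hfloor := Nat.lt_floor_add_one ((1 + ‖y - x‖) / 2)
  have hnear_final : ∑' h, Fn h ≤ Kn * (1 + ‖y - x‖) ^ (2 * β - α) := by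
    refine hnle.trans ?_
    have hrD : (⌊(1 + ‖y - x‖) / 2⌋₊ : ℝ) ≤ (1 + ‖y - x‖) / 2 := Nat.floor_le (by positivity)
    have hrpow : (⌊(1 + ‖y - x‖) / 2⌋₊ : ℝ) ^ ((d : ℝ) + (2 - ((d : ℝ) + α))) ≤
        ((1 + ‖y - x‖) / 2) ^ ((d : ℝ) + (2 - ((d : ℝ) + α))) :=
      Real.rpow_le_rpow (Nat.cast_nonneg _) hrD (by linarith)
    have hcomb : ((1 + ‖y - x‖) / 2) ^ (2 * β - 2) * ((1 + ‖y - x‖) / 2) ^ ((d : ℝ) + (2 - ((d : ℝ) + α))) =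
        (2 : ℝ) ^ (α - 2 * β) * (1 + ‖y - x‖) ^ (2 * β - α) := by
      rw [← Real.rpow_add (by positivity),
        show 2 * β - 2 + ((d : ℝ) + (2 - ((d : ℝ) + α))) = 2 * β - α by ring,
        Real.div_rpow hDpos.le (by norm_num), div_eq_mul_inv, ← Real.rpow_neg (by norm_num),
        neg_sub, mul_comm]
    calc (c₂ * (2 : ℝ) ^ ((d : ℝ) + α) * (M / m + 1)) * β ^ 2 * ((1 + ‖y - x‖) / 2) ^ (2 * β - 2) *
          (2 * (d : ℝ) * 3 ^ (d - 1) * (1 + 1 / (d + (2 - ((d : ℝ) + α))))) *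
          (⌊(1 + ‖y - x‖) / 2⌋₊ : ℝ) ^ ((d : ℝ) + (2 - ((d : ℝ) + α)))
        ≤ (c₂ * (2 : ℝ) ^ ((d : ℝ) + α) * (M / m + 1)) * β ^ 2 * ((1 + ‖y - x‖) / 2) ^ (2 * β - 2) *
          (2 * (d : ℝ) * 3 ^ (d - 1) * (1 + 1 / (d + (2 - ((d : ℝ) + α))))) *
          ((1 + ‖y - x‖) / 2) ^ ((d : ℝ) + (2 - ((d : ℝ) + α))) :=
          mul_le_mul_of_nonneg_left hrpow (by positivity)
      _ = (c₂ * (2 : ℝ) ^ ((d : ℝ) + α) * (M / m + 1)) * β ^ 2 *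
          (2 * (d : ℝ) * 3 ^ (d - 1) * (1 + 1 / (d + (2 - ((d : ℝ) + α))))) *
          (((1 + ‖y - x‖) / 2) ^ (2 * β - 2) * ((1 + ‖y - x‖) / 2) ^ ((d : ℝ) + (2 - ((d : ℝ) + α)))) := by
          ring
      _ = Kn * (1 + ‖y - x‖) ^ (2 * β - α) := by rw [hcomb, hKn_def]; ring
  have hfar_final : ∑' h, Ff h ≤ Kf * (1 + ‖y - x‖) ^ (2 * β - α) := by
    have hAnn : 0 ≤ (c₂ * (2 : ℝ) ^ ((d : ℝ) + α) * (M / m + 1)) * (2 * (4 : ℝ) ^ β + 2 * (9 : ℝ) ^ β) := by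
      positivity
    rcases Nat.eq_zero_or_pos (⌊(1 + ‖y - x‖) / 2⌋₊) with hr0 | hrpos
    · -- D < 2: use the total bound
      have hD2 : 1 + ‖y - x‖ < 2 := by
        rw [hr0] at hfloor; simp at hfloor; linarith
      have hDpow : 1 ≤ (4 : ℝ) ^ (α - 2 * β) * (1 + ‖y - x‖) ^ (2 * β - α) := by
        have : (4 : ℝ) ^ (2 * β - α) ≤ (1 + ‖y - x‖) ^ (2 * β - α) :=
          Real.rpow_le_rpow_of_nonpos hDpos (by linarith) (by linarith)
        calc (1 : ℝ) = (4 : ℝ) ^ (α - 2 * β) * (4 : ℝ) ^ (2 * β - α) := by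
              rw [← Real.rpow_add (by norm_num)]; norm_num
          _ ≤ (4 : ℝ) ^ (α - 2 * β) * (1 + ‖y - x‖) ^ (2 * β - α) := mul_le_mul_of_nonneg_left this h4nn
      calc ∑' h, Ff h ≤ _ := hfle0
        _ ≤ (c₂ * (2 : ℝ) ^ ((d : ℝ) + α) * (M / m + 1)) * (2 * (4 : ℝ) ^ β + 2 * (9 : ℝ) ^ β) *
            (3 ^ d + 2 * (d : ℝ) * 3 ^ (d - 1) / (((d : ℝ) + α) - 2 * β - d)) *
            ((4 : ℝ) ^ (α - 2 * β) * (1 + ‖y - x‖) ^ (2 * β - α)) :=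
            le_mul_of_one_le_right (mul_nonneg hAnn hZt) hDpow
        _ ≤ Kf * (1 + ‖y - x‖) ^ (2 * β - α) := by
            rw [hKf_def]
            have hx : 0 ≤ (c₂ * (2 : ℝ) ^ ((d : ℝ) + α) * (M / m + 1)) * (2 * (4 : ℝ) ^ β + 2 * (9 : ℝ) ^ β) *
                (2 * (d : ℝ) * 3 ^ (d - 1) / (((d : ℝ) + α) - 2 * β - d)) * (4 : ℝ) ^ (α - 2 * β) *
                (1 + ‖y - x‖) ^ (2 * β - α) :=
              mul_nonneg (mul_nonneg (mul_nonneg hAnn hLf) h4nn) hDe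
            have heq : (c₂ * (2 : ℝ) ^ ((d : ℝ) + α) * (M / m + 1)) * (2 * (4 : ℝ) ^ β + 2 * (9 : ℝ) ^ β) *
                ((2 * (d : ℝ) * 3 ^ (d - 1) / (((d : ℝ) + α) - 2 * β - d)) * (4 : ℝ) ^ (α - 2 * β) +
                  (3 ^ d + 2 * (d : ℝ) * 3 ^ (d - 1) / (((d : ℝ) + α) - 2 * β - d)) * (4 : ℝ) ^ (α - 2 * β)) *
                (1 + ‖y - x‖) ^ (2 * β - α) =
              (c₂ * (2 : ℝ) ^ ((d : ℝ) + α) * (M / m + 1)) * (2 * (4 : ℝ) ^ β + 2 * (9 : ℝ) ^ β) *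
                (3 ^ d + 2 * (d : ℝ) * 3 ^ (d - 1) / (((d : ℝ) + α) - 2 * β - d)) *
                ((4 : ℝ) ^ (α - 2 * β) * (1 + ‖y - x‖) ^ (2 * β - α)) +
              (c₂ * (2 : ℝ) ^ ((d : ℝ) + α) * (M / m + 1)) * (2 * (4 : ℝ) ^ β + 2 * (9 : ℝ) ^ β) *
                (2 * (d : ℝ) * 3 ^ (d - 1) / (((d : ℝ) + α) - 2 * β - d)) * (4 : ℝ) ^ (α - 2 * β) *
                (1 + ‖y - x‖) ^ (2 * β - α) := by ring
            rw [heq]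
            linarith
    · have hrD : (1 + ‖y - x‖) / 4 ≤ (⌊(1 + ‖y - x‖) / 2⌋₊ : ℝ) := by
        have h2 : (1 : ℝ) ≤ (⌊(1 + ‖y - x‖) / 2⌋₊ : ℝ) := by exact_mod_cast hrpos
        linarith
      have hD4 : 0 < (1 + ‖y - x‖) / 4 := by linarith
      have hexneg : (d : ℝ) - (((d : ℝ) + α) - 2 * β) ≤ 0 := by linarith
      have hrpow : (⌊(1 + ‖y - x‖) / 2⌋₊ : ℝ) ^ ((d : ℝ) - (((d : ℝ) + α) - 2 * β)) ≤
          ((1 + ‖y - x‖) / 4) ^ ((d : ℝ) - (((d : ℝ) + α) - 2 * β)) :=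
        Real.rpow_le_rpow_of_nonpos hD4 hrD hexneg
      have hexp : ((1 + ‖y - x‖) / 4) ^ ((d : ℝ) - (((d : ℝ) + α) - 2 * β)) =
          (4 : ℝ) ^ (α - 2 * β) * (1 + ‖y - x‖) ^ (2 * β - α) := by
        have : (d : ℝ) - (((d : ℝ) + α) - 2 * β) = 2 * β - α := by ring
        rw [this, Real.div_rpow hDpos.le (by norm_num), div_eq_mul_inv, ← Real.rpow_neg (by norm_num),
          neg_sub, mul_comm]
      calc ∑' h, Ff h ≤ _ := hfle1 hrpos
        _ ≤ (c₂ * (2 : ℝ) ^ ((d : ℝ) + α) * (M / m + 1)) * (2 * (4 : ℝ) ^ β + 2 * (9 : ℝ) ^ β) *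
            (2 * (d : ℝ) * 3 ^ (d - 1) / (((d : ℝ) + α) - 2 * β - d)) *
            ((4 : ℝ) ^ (α - 2 * β) * (1 + ‖y - x‖) ^ (2 * β - α)) := by
            rw [← hexp]
            exact mul_le_mul_of_nonneg_left hrpow (mul_nonneg hAnn hLf)
        _ ≤ Kf * (1 + ‖y - x‖) ^ (2 * β - α) := by
            rw [hKf_def]
            have hx : 0 ≤ (c₂ * (2 : ℝ) ^ ((d : ℝ) + α) * (M / m + 1)) * (2 * (4 : ℝ) ^ β + 2 * (9 : ℝ) ^ β) *
                (3 ^ d + 2 * (d : ℝ) * 3 ^ (d - 1) / (((d : ℝ) + α) - 2 * β - d)) * (4 : ℝ) ^ (α - 2 * β) *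
                (1 + ‖y - x‖) ^ (2 * β - α) :=
              mul_nonneg (mul_nonneg (mul_nonneg hAnn hZt) h4nn) hDe
            have heq : (c₂ * (2 : ℝ) ^ ((d : ℝ) + α) * (M / m + 1)) * (2 * (4 : ℝ) ^ β + 2 * (9 : ℝ) ^ β) *
                ((2 * (d : ℝ) * 3 ^ (d - 1) / (((d : ℝ) + α) - 2 * β - d)) * (4 : ℝ) ^ (α - 2 * β) +
                  (3 ^ d + 2 * (d : ℝ) * 3 ^ (d - 1) / (((d : ℝ) + α) - 2 * β - d)) * (4 : ℝ) ^ (α - 2 * β)) *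
                (1 + ‖y - x‖) ^ (2 * β - α) =
              (c₂ * (2 : ℝ) ^ ((d : ℝ) + α) * (M / m + 1)) * (2 * (4 : ℝ) ^ β + 2 * (9 : ℝ) ^ β) *
                (2 * (d : ℝ) * 3 ^ (d - 1) / (((d : ℝ) + α) - 2 * β - d)) *
                ((4 : ℝ) ^ (α - 2 * β) * (1 + ‖y - x‖) ^ (2 * β - α)) +
              (c₂ * (2 : ℝ) ^ ((d : ℝ) + α) * (M / m + 1)) * (2 * (4 : ℝ) ^ β + 2 * (9 : ℝ) ^ β) *
                (3 ^ d + 2 * (d : ℝ) * 3 ^ (d - 1) / (((d : ℝ) + α) - 2 * β - d)) * (4 : ℝ) ^ (α - 2 * β) *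
                (1 + ‖y - x‖) ^ (2 * β - α) := by ring
            rw [heq]
            linarith
  calc ∑' z, Q 2 y z * ((1 + ‖y - x‖) ^ β - (1 + ‖z - x‖) ^ β) ^ 2
      ≤ ∑' z, (Fn (z - y) + Ff (z - y)) := Summable.tsum_le_tsum hpt' hsum_z hmaj_s
    _ = ∑' h, (Fn h + Ff h) := (Equiv.subRight y).tsum_eq (fun h => Fn h + Ff h)
    _ = ∑' h, Fn h + ∑' h, Ff h := Summable.tsum_add hns hfs
    _ ≤ Kn * (1 + ‖y - x‖) ^ (2 * β - α) + Kf * (1 + ‖y - x‖) ^ (2 * β - α) :=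
        add_le_add hnear_final hfar_final
    _ = (Kn + Kf) * (1 + ‖y - x‖) ^ (2 * β - α) := by ring
    _ ≤ (Kn + Kf + 1) * (1 + ‖y - x‖) ^ (2 * β - α) := mul_le_mul_of_nonneg_right (by linarith) hDe

/-! ### Anti-concentration from the on-diagonal bound -/

/-- **Inverse moments (anti-concentration).** If `Q n x y ≤ C_D n^{-d/α}` for `n ≥ 1`, then for
`0 < γ < d`, `γ ≤ ... ` : `∑_z Q n x z (1+‖z−x‖)^{-γ} ≤ C n^{-γ/α}` for all `n ≥ 1`. [folklore] -/
theorem inverse_moment_bound (hd : 1 ≤ d) (hα : 0 < α) (hP0 : ∀ x y, 0 ≤ P x y)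
    (hP1 : ∀ x, HasSum (P x) 1)
    (hQ0 : ∀ x y, Q 0 x y = if x = y then 1 else 0)
    (hQ : ∀ n x y, Q (n + 1) x y = ∑' z, Q n x z * P z y)
    {C_D : ℝ} (hCD : 0 ≤ C_D)
    (hdiag : ∀ (n : ℕ) (x y : Fin d → ℤ), 1 ≤ n → Q n x y ≤ C_D * (n : ℝ) ^ (-(d : ℝ) / α))
    {γ : ℝ} (hγ : 0 < γ) (hγd : γ < d) :
    ∃ C : ℝ, 0 < C ∧ ∀ (n : ℕ) (x : Fin d → ℤ), 1 ≤ n →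
      (Summable fun z => Q n x z * (1 + ‖z - x‖) ^ (-γ)) ∧
      ∑' z, Q n x z * (1 + ‖z - x‖) ^ (-γ) ≤ C * (n : ℝ) ^ (-γ / α) := by
  have hPs : ∀ x, Summable (P x) := fun x => (hP1 x).summable
  have hP1' : ∀ x, ∑' y, P x y ≤ 1 := fun x => ((hP1 x).tsum_eq).le
  have hQnn : ∀ k x w, 0 ≤ Q k x w := kpow_nonneg hP0 hQ0 hQ
  have hγ' : -(d : ℝ) < -γ := by linarith
  set L : ℝ := 2 * d * 3 ^ (d - 1) * (1 + 1 / (d + -γ)) with hL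
  have hLnn : 0 ≤ L := by
    rw [hL]
    have : 0 < (d : ℝ) + -γ := by linarith
    positivity
  refine ⟨C_D * (1 + L) + 1, by positivity, fun n x hn => ?_⟩
  have hn0 : (0 : ℝ) < n := by exact_mod_cast hn
  have hw1 : ∀ z : Fin d → ℤ, (1 + ‖z - x‖) ^ (-γ) ≤ 1 := fun z =>
    Real.rpow_le_one_of_one_le_of_nonpos (by linarith [norm_nonneg (z - x)]) (by linarith)
  have hwnn : ∀ z : Fin d → ℤ, 0 ≤ (1 + ‖z - x‖) ^ (-γ) := fun z => Real.rpow_nonneg (by positivity) _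
  have hsum : Summable fun z => Q n x z * (1 + ‖z - x‖) ^ (-γ) :=
    (kpow_summable hP0 hPs hP1' hQ0 hQ n x).of_nonneg_of_le (fun z => mul_nonneg (hQnn n x z) (hwnn z))
      (fun z => mul_le_of_le_one_right (hQnn n x z) (hw1 z))
  refine ⟨hsum, ?_⟩
  -- the scale ρ = ⌊n^{1/α}⌋ ≥ 1
  set R : ℝ := (n : ℝ) ^ (1 / α) with hR
  have hR1 : 1 ≤ R := Real.one_le_rpow (by exact_mod_cast hn) (by positivity)
  have hRpos : 0 < R := by linarith
  set ρ : ℕ := ⌊R⌋₊ with hρ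
  have hρ1 : 1 ≤ ρ := Nat.le_floor (by simpa using hR1)
  have hρR : (ρ : ℝ) ≤ R := Nat.floor_le hRpos.le
  have hRρ : R < (ρ : ℝ) + 1 := Nat.lt_floor_add_one R
  -- majorants
  obtain ⟨Gn, hGn⟩ : ∃ Gn : (Fin d → ℤ) → ℝ, ∀ h, Gn h =
      if ‖h‖ ≤ ρ then C_D * (n : ℝ) ^ (-(d : ℝ) / α) * (1 + ‖h‖) ^ (-γ) else 0 := ⟨_, fun h => rfl⟩
  have hGn_nn : ∀ h, 0 ≤ Gn h := by
    intro h; rw [hGn]; split_ifs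
    · exact mul_nonneg (by positivity) (Real.rpow_nonneg (by positivity) _)
    · exact le_rfl
  have hpt : ∀ z, Q n x z * (1 + ‖z - x‖) ^ (-γ) ≤ Gn (z - x) + (n : ℝ) ^ (-γ / α) * Q n x z := by
    intro z
    by_cases hz : ‖z - x‖ ≤ ρ
    · rw [hGn, if_pos hz]
      calc Q n x z * (1 + ‖z - x‖) ^ (-γ) ≤ C_D * (n : ℝ) ^ (-(d : ℝ) / α) * (1 + ‖z - x‖) ^ (-γ) :=
            mul_le_mul_of_nonneg_right (hdiag n x z hn) (hwnn z)
        _ ≤ _ := le_add_of_nonneg_right (mul_nonneg (Real.rpow_nonneg hn0.le _) (hQnn n x z))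
    · push Not at hz
      have hfar : (1 + ‖z - x‖) ^ (-γ) ≤ (n : ℝ) ^ (-γ / α) := by
        have h1 : R ≤ 1 + ‖z - x‖ := by
          have : (ρ : ℝ) + 1 ≤ ‖z - x‖ + 1 := by
            obtain ⟨k, hk⟩ := exists_norm_eq_natCast (z - x)
            rw [hk] at hz ⊢
            have : ρ + 1 ≤ k := by exact_mod_cast hz
            exact_mod_cast (by omega : ρ + 1 ≤ k + 1)
          linarith
        calc (1 + ‖z - x‖) ^ (-γ) ≤ R ^ (-γ) := Real.rpow_le_rpow_of_nonpos hRpos h1 (by linarith)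
          _ = (n : ℝ) ^ (-γ / α) := by
              rw [hR, ← Real.rpow_mul hn0.le]; congr 1; field_simp
      calc Q n x z * (1 + ‖z - x‖) ^ (-γ) ≤ Q n x z * (n : ℝ) ^ (-γ / α) :=
            mul_le_mul_of_nonneg_left hfar (hQnn n x z)
        _ = (n : ℝ) ^ (-γ / α) * Q n x z := mul_comm _ _
        _ ≤ _ := le_add_of_nonneg_left (hGn_nn _)
  -- the near majorant: finitely supported, bounded sum
  set B : Finset (Fin d → ℤ) := Fintype.piFinset (fun _ : Fin d => Finset.Icc (-(ρ : ℤ)) ρ) with hB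
  have hsupp : ∀ h, h ∉ B → Gn h = 0 := by
    intro h hh; rw [hGn, if_neg]; exact fun hc => hh ((mem_box_iff h ρ).mpr hc)
  have hGs : Summable Gn := summable_of_ne_finset_zero hsupp
  have hGsum : ∑' h, Gn h ≤ C_D * (n : ℝ) ^ (-(d : ℝ) / α) * (1 + L * R ^ ((d : ℝ) - γ)) := by
    rw [tsum_eq_sum hsupp]
    have h0 : (0 : Fin d → ℤ) ∈ B := (mem_box_iff 0 ρ).mpr (by simp)
    rw [← Finset.add_sum_erase B _ h0]
    have hz : Gn 0 = C_D * (n : ℝ) ^ (-(d : ℝ) / α) := by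
      rw [hGn, if_pos (by simp)]; simp
    have heq : ∀ h ∈ B.erase 0, Gn h ≤ C_D * (n : ℝ) ^ (-(d : ℝ) / α) * ‖h‖ ^ (-γ) := by
      intro h hh
      have hh' := Finset.mem_erase.mp hh
      rw [hGn, if_pos ((mem_box_iff h ρ).mp hh'.2)]
      refine mul_le_mul_of_nonneg_left ?_ (by positivity)
      have hpos : 0 < ‖h‖ := norm_pos_iff.mpr hh'.1
      exact Real.rpow_le_rpow_of_nonpos hpos (by linarith) (by linarith)
    have hinner := sum_norm_rpow_le_of_norm_le hd hγ' ρ (B.erase 0) (fun h hh => by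
      have hh' := Finset.mem_erase.mp hh
      exact ⟨hh'.1, (mem_box_iff h ρ).mp hh'.2⟩)
    have hρpow : (ρ : ℝ) ^ ((d : ℝ) + -γ) ≤ R ^ ((d : ℝ) - γ) := by
      rw [← sub_eq_add_neg]
      exact Real.rpow_le_rpow (Nat.cast_nonneg ρ) hρR (by linarith)
    calc Gn 0 + ∑ h ∈ B.erase 0, Gn h
        ≤ C_D * (n : ℝ) ^ (-(d : ℝ) / α) + ∑ h ∈ B.erase 0, C_D * (n : ℝ) ^ (-(d : ℝ) / α) * ‖h‖ ^ (-γ) := by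
          rw [hz]; exact add_le_add le_rfl (Finset.sum_le_sum heq)
      _ = C_D * (n : ℝ) ^ (-(d : ℝ) / α) * (1 + ∑ h ∈ B.erase 0, ‖h‖ ^ (-γ)) := by
          rw [← Finset.mul_sum]; ring
      _ ≤ C_D * (n : ℝ) ^ (-(d : ℝ) / α) * (1 + L * R ^ ((d : ℝ) - γ)) := by
          refine mul_le_mul_of_nonneg_left (add_le_add le_rfl ?_) (by positivity)
          calc ∑ h ∈ B.erase 0, ‖h‖ ^ (-γ) ≤ L * (ρ : ℝ) ^ ((d : ℝ) + -γ) := by rw [hL]; exact hinner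
            _ ≤ L * R ^ ((d : ℝ) - γ) := mul_le_mul_of_nonneg_left hρpow hLnn
  -- powers of n
  have hnd : (n : ℝ) ^ (-(d : ℝ) / α) ≤ (n : ℝ) ^ (-γ / α) := by
    refine Real.rpow_le_rpow_of_exponent_le (by exact_mod_cast hn) ?_
    rw [neg_div, neg_div, neg_le_neg_iff]
    exact div_le_div_of_nonneg_right hγd.le hα.le
  have hnR : (n : ℝ) ^ (-(d : ℝ) / α) * R ^ ((d : ℝ) - γ) = (n : ℝ) ^ (-γ / α) := by
    rw [hR, ← Real.rpow_mul hn0.le, ← Real.rpow_add hn0]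
    congr 1; field_simp; ring
  have hGs' : Summable fun z : Fin d → ℤ => Gn (z - x) := (Equiv.subRight x).summable_iff.mpr hGs
  have hGtsum : ∑' z : Fin d → ℤ, Gn (z - x) = ∑' h, Gn h := (Equiv.subRight x).tsum_eq Gn
  have hmaj_s : Summable fun z => Gn (z - x) + (n : ℝ) ^ (-γ / α) * Q n x z :=
    hGs'.add ((kpow_summable hP0 hPs hP1' hQ0 hQ n x).mul_left _)
  calc ∑' z, Q n x z * (1 + ‖z - x‖) ^ (-γ)
      ≤ ∑' z, (Gn (z - x) + (n : ℝ) ^ (-γ / α) * Q n x z) := Summable.tsum_le_tsum hpt hsum hmaj_s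
    _ = ∑' z, Gn (z - x) + (n : ℝ) ^ (-γ / α) * ∑' z, Q n x z := by
        rw [Summable.tsum_add hGs' ((kpow_summable hP0 hPs hP1' hQ0 hQ n x).mul_left _), tsum_mul_left]
    _ ≤ C_D * (n : ℝ) ^ (-(d : ℝ) / α) * (1 + L * R ^ ((d : ℝ) - γ)) + (n : ℝ) ^ (-γ / α) * 1 := by
        refine add_le_add ?_ (mul_le_mul_of_nonneg_left (kpow_tsum_le_one hP0 hPs hP1' hQ0 hQ n x)
          (Real.rpow_nonneg hn0.le _))
        rw [hGtsum]; exact hGsum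
    _ = C_D * (n : ℝ) ^ (-(d : ℝ) / α) + C_D * L * ((n : ℝ) ^ (-(d : ℝ) / α) * R ^ ((d : ℝ) - γ)) +
          (n : ℝ) ^ (-γ / α) := by ring
    _ ≤ C_D * (n : ℝ) ^ (-γ / α) + C_D * L * (n : ℝ) ^ (-γ / α) + (n : ℝ) ^ (-γ / α) := by
        rw [hnR]
        linarith [mul_le_mul_of_nonneg_left hnd hCD]
    _ = (C_D * (1 + L) + 1) * (n : ℝ) ^ (-γ / α) := by ring

end Literature.Probability.Process
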